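import Summits.ResolutionOfSingularities.ResolutionOfSingularities.Theorems.FrobeniusLadderFInjectiveMacaulayficationDeformation
import Literature.AlgebraicGeometry.Resolution.BlowupChartTransition
import Literature.AlgebraicGeometry.Resolution.AffineBlowupAlgebra
import Mathlib.Algebra.CharP.Algebra
import Mathlib.RingTheory.Localization.AtPrime.Basic
import HarnessLib

/-!
# R1 «exceptional slices FULL ⇒ PFix» — the class theorem of route T-F in chart language (crux `FInjectiveMacaulayfication`, line T-F under #4β)

Support file for crux stmt-ResolutionOfSingularities-15315 (`FrobeniusLadder.FInjectiveMacaulayfication`), chain w45a. [OURS · L1 W4.5a] —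
NOT a statement of any manuscript [claim: Hironaka2017]; AI-written, weaker than expert review; no statement of the manuscript is used.
Text of record: res-L1-w45a-strat-1 `H4LocRepairSig.lean` v1.9 8b210aa15814420d §10⁗ (= v1.10 a1babb9a53588df4 ll. 694–770, unchanged),
`pfixData_of_exceptionalSlices`; gate words: res-L1-w45a-tri-2 JUNK + «≤ S» PASS 2026-08-27T16:29:30Z; filer res-L1-w45a-stub-3 (RULING
R13.49 (1)(β′) of res-L1-w45a-plan-1).  PRESENTATION: the proof body is byte-verbatim; in the STATEMENT the reducible clause abbreviations
`CMCl` / `FCl` / `FullCl` / `PFixData` of the Sig's §1′ are EXPANDED to the tree's clause texts (so the conclusion is literally the PFix text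
of `PointFixDimOne.pointFix_of_dim_one` / the `h4Loc` binder), and the named fact `CMFIDeforms` (FACT F-90 «CM + F-injective deform along a
nonzerodivisor», Fedder 1983 Thm. 3.4 (1) + Matsumura Thm. 17.3 + Quy–Shimomoto 2017 Cor. 3.9; Literature file by res-D-pv-036 pending)
enters as the hypothesis `hFed` spelled BY TEXT (its clause form, Sig l.623 verbatim with the abbreviations inlined) — so this file declares
no definition, and `hFed := <the Literature fact>` applies by unfolding once F-90 lands.  Plug test against the Sig (scratch, not filed):
`example (hFed : CMFIDeforms) … : PFixData p A := pfixData_of_exceptionalSlices hFed hp c hc0 hne hrad hE` elaborates by `rfl`-unfolding.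

Mathematical content (strat-1's §10⁗ module text, verbatim):

The projectivised tangent cone `E_𝔪 = Proj(gr_𝔪 𝒪_{X₁,b})` meets the `j`-th affine chart `Spec A[𝔪/c_j]` of `Bl_𝔪` in
`Spec (A[𝔪/c_j] ⧸ (c_j))` (`𝔪·A[𝔪/c_j] = (c_j)`, Stacks 07Z3 (2)); so «`E_𝔪` is Cohen–Macaulay and `F`-injective at its points over `b`»
is, chart by chart, the hypothesis `hE` below — the CM clause and the F-clause of the LOCALISED chart ring modulo the image of `c_j` — and
no `Proj gr_𝔪` API is needed for the KERNEL (only for the geometric reading).  More generally the centre may be any `𝔪`-primary `(c)`: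
the slice is the local equation `c_j` of the exceptional Cartier divisor `E_{(c)} ∩ chart_j`.  The theorem: **if every exceptional slice is
CM + F-injective, then `PFixData p A`** (= 5e⁺'s conclusion at `A = 𝒪_{X₁,b}`) — modulo the named fact `CMFIDeforms` (Fedder 1983
Thm 3.4 (1) [corpus: paper:doi-10-1090-s0002-9947-1983-0701505-0 p.14] + Matsumura 17.3 + Quy–Shimomoto 2017 §3).  Examples where
`hE` holds with `(c) = 𝔪` (ROUTES-DIM4 §1/§3): cones over ORDINARY elliptic curves / F-split CM projective varieties (all `d`), the
`E₇`-type point `x²+y³+yz³` in char 5 (tangent cone a double plane — NOT reduced: `hE` FAILS there; that point is FULL for another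
reason, F-purity by Fedder), rational `m`-fold points with reduced F-injective tangent cone.  Where it fails: `E₈⁰`, weighted points,
and every WILD point through normalisation-type centres (tri-2 ADDENDUM 16:16:33Z: three coplanar concurrent lines as transversal type).
[OURS · kernel glue sorry-free; mathematics = Fedder's deformation, entering BY NAME]
-/

-- single-problem summit: the doubled namespace component is forced
set_option linter.dupNamespace false

noncomputable section

open AlgebraicGeometry CategoryTheory Literature.AlgebraicGeometry.Resolution TopologicalSpace IsLocalRing

namespace Summit.ResolutionOfSingularities.ResolutionOfSingularities.Theorems.FInjectiveMacaulayfication.ExceptionalSlices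

/-- **R1 (chart form).** For a Noetherian local domain `(A, 𝔪)` of characteristic `p` and NONZERO generators `c` of an `𝔪`-primary
ideal: if at every prime `𝔔` of every chart `A[(c)/c_j]` lying over `𝔪` the localised chart ring modulo the image of `c_j` (= the local
ring of the exceptional divisor `E_{(c)}` at `𝔔`; stated for ANY presentation `L` of the localisation, which also sidesteps the
`Subalgebra`/`Localization` instance diamond on `⧸`) satisfies the CM clause and the F-clause, then `(c)` is a PFix-centre:
`PFixData p A`.  Proof: `c_j` is a nonzerodivisor of the domain `A[(c)/c_j]_𝔔` lying in its maximal ideal, so `CMFIDeforms` lifts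
both clauses from the slice; domain-ness is inherited from `A ⊆ A[(c)/c_j] ⊆ A[1/c_j]`.
[cite: Fedder1983, Thm. 3.4 (1)] [cite: Matsumura1987, Thm. 17.3] [cite: QuyShimomoto2017, §3] [cite: StacksProject, Tag 07Z3] -/
theorem pfixData_of_exceptionalSlices
    (hFed : ∀ (p : ℕ), p.Prime → ∀ (R : Type) [CommRing R] [IsNoetherianRing R] [IsLocalRing R] [CharP R p] (t : R),
      t ∈ maximalIdeal R → t ∈ nonZeroDivisors R →
      (∀ d : ℕ, ringKrullDim (R ⧸ Ideal.span {t}) = d → ∀ s : Fin d → (R ⧸ Ideal.span {t}), (Ideal.span (Set.range s)).radical.IsMaximal →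
        RingTheory.Sequence.IsWeaklyRegular (R ⧸ Ideal.span {t}) (List.ofFn s)) →
      (∀ d : ℕ, ringKrullDim (R ⧸ Ideal.span {t}) = d → ∀ s : Fin d → (R ⧸ Ideal.span {t}), (Ideal.span (Set.range s)).radical.IsMaximal →
        ∀ y : (R ⧸ Ideal.span {t}), (∃ e : ℕ, y ^ p ^ e ∈ Ideal.span ((fun z : (R ⧸ Ideal.span {t}) => z ^ p ^ e) '' (Ideal.span (Set.range s) : Set (R ⧸ Ideal.span {t})))) →
          y ∈ Ideal.span (Set.range s)) →
      (∀ d : ℕ, ringKrullDim R = d → ∀ s : Fin d → R, (Ideal.span (Set.range s)).radical.IsMaximal →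
        RingTheory.Sequence.IsWeaklyRegular R (List.ofFn s)) ∧
      (∀ d : ℕ, ringKrullDim R = d → ∀ s : Fin d → R, (Ideal.span (Set.range s)).radical.IsMaximal →
        ∀ y : R, (∃ e : ℕ, y ^ p ^ e ∈ Ideal.span ((fun z : R => z ^ p ^ e) '' (Ideal.span (Set.range s) : Set R))) →
          y ∈ Ideal.span (Set.range s)))
    {p : ℕ} (hp : p.Prime)
    {A : Type} [CommRing A] [IsDomain A] [IsNoetherianRing A] [IsLocalRing A] [CharP A p]
    {n : ℕ} (c : Fin n → A) (hc0 : ∀ j, c j ≠ 0) (hne : Ideal.span (Set.range c) ≠ ⊥)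
    (hrad : (Ideal.span (Set.range c)).radical = maximalIdeal A)
    (hE : ∀ (j : Fin n) (𝔔 : PrimeSpectrum (blowupAlgebra (Ideal.span (Set.range c)) (c j))),
      𝔔.asIdeal.comap (algebraMap A (blowupAlgebra (Ideal.span (Set.range c)) (c j))) = maximalIdeal A →
        ∀ (L : Type) [CommRing L] [Algebra (blowupAlgebra (Ideal.span (Set.range c)) (c j)) L]
          [IsLocalization.AtPrime L 𝔔.asIdeal],
        (∀ d : ℕ, ringKrullDim (L ⧸ Ideal.span {algebraMap (blowupAlgebra (Ideal.span (Set.range c)) (c j)) L (algebraMap A (blowupAlgebra (Ideal.span (Set.range c)) (c j)) (c j))}) = d → ∀ s : Fin d → (L ⧸ Ideal.span {algebraMap (blowupAlgebra (Ideal.span (Set.range c)) (c j)) L (algebraMap A (blowupAlgebra (Ideal.span (Set.range c)) (c j)) (c j))}), (Ideal.span (Set.range s)).radical.IsMaximal →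
          RingTheory.Sequence.IsWeaklyRegular (L ⧸ Ideal.span {algebraMap (blowupAlgebra (Ideal.span (Set.range c)) (c j)) L (algebraMap A (blowupAlgebra (Ideal.span (Set.range c)) (c j)) (c j))}) (List.ofFn s)) ∧
        (∀ d : ℕ, ringKrullDim (L ⧸ Ideal.span {algebraMap (blowupAlgebra (Ideal.span (Set.range c)) (c j)) L (algebraMap A (blowupAlgebra (Ideal.span (Set.range c)) (c j)) (c j))}) = d → ∀ s : Fin d → (L ⧸ Ideal.span {algebraMap (blowupAlgebra (Ideal.span (Set.range c)) (c j)) L (algebraMap A (blowupAlgebra (Ideal.span (Set.range c)) (c j)) (c j))}), (Ideal.span (Set.range s)).radical.IsMaximal →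
          ∀ y : (L ⧸ Ideal.span {algebraMap (blowupAlgebra (Ideal.span (Set.range c)) (c j)) L (algebraMap A (blowupAlgebra (Ideal.span (Set.range c)) (c j)) (c j))}), (∃ e : ℕ, y ^ p ^ e ∈ Ideal.span ((fun z : (L ⧸ Ideal.span {algebraMap (blowupAlgebra (Ideal.span (Set.range c)) (c j)) L (algebraMap A (blowupAlgebra (Ideal.span (Set.range c)) (c j)) (c j))}) => z ^ p ^ e) '' (Ideal.span (Set.range s) : Set (L ⧸ Ideal.span {algebraMap (blowupAlgebra (Ideal.span (Set.range c)) (c j)) L (algebraMap A (blowupAlgebra (Ideal.span (Set.range c)) (c j)) (c j))})))) →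
            y ∈ Ideal.span (Set.range s))) :
    ∃ (n : ℕ) (c : Fin n → A), Ideal.span (Set.range c) ≠ ⊥ ∧ (Ideal.span (Set.range c)).radical = maximalIdeal A ∧
      ∀ (j : Fin n) (𝔔 : PrimeSpectrum (blowupAlgebra (Ideal.span (Set.range c)) (c j))),
        𝔔.asIdeal.comap (algebraMap A (blowupAlgebra (Ideal.span (Set.range c)) (c j))) = maximalIdeal A →
        (IsDomain (Localization.AtPrime 𝔔.asIdeal) ∧ ∀ d : ℕ, ringKrullDim (Localization.AtPrime 𝔔.asIdeal) = d → ∀ s : Fin d → (Localization.AtPrime 𝔔.asIdeal), (Ideal.span (Set.range s)).radical.IsMaximal →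
          RingTheory.Sequence.IsWeaklyRegular (Localization.AtPrime 𝔔.asIdeal) (List.ofFn s) ∧
          ∀ y : (Localization.AtPrime 𝔔.asIdeal), (∃ e : ℕ, y ^ p ^ e ∈ Ideal.span ((fun z : (Localization.AtPrime 𝔔.asIdeal) => z ^ p ^ e) '' (Ideal.span (Set.range s) : Set (Localization.AtPrime 𝔔.asIdeal)))) →
            y ∈ Ideal.span (Set.range s)) := by
  refine ⟨n, c, hne, hrad, fun j 𝔔 h𝔔 => ?_⟩
  -- notation-free abbreviations
  have hcj : c j ≠ 0 := hc0 j
  haveI : IsDomain (Localization.Away (c j)) :=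
    IsLocalization.isDomain_localization (powers_le_nonZeroDivisors_of_noZeroDivisors hcj)
  haveI hBdom : IsDomain (blowupAlgebra (Ideal.span (Set.range c)) (c j)) := inferInstance
  haveI : IsNoetherianRing (blowupAlgebra (Ideal.span (Set.range c)) (c j)) :=
    isNoetherianRing_blowupAlgebra_of_isNoetherianRing (Ideal.span (Set.range c)) (c j)
  haveI hLdom : IsDomain (Localization.AtPrime 𝔔.asIdeal) :=
    IsLocalization.isDomain_localization (Ideal.primeCompl_le_nonZeroDivisors 𝔔.asIdeal)
  haveI : IsNoetherianRing (Localization.AtPrime 𝔔.asIdeal) :=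
    IsLocalization.isNoetherianRing 𝔔.asIdeal.primeCompl _ inferInstance
  haveI : CharP (Localization.AtPrime 𝔔.asIdeal) p :=
    CharP.of_ringHom_of_ne_zero ((algebraMap (blowupAlgebra (Ideal.span (Set.range c)) (c j))
      (Localization.AtPrime 𝔔.asIdeal)).comp (algebraMap A (blowupAlgebra (Ideal.span (Set.range c)) (c j)))) p hp.ne_zero
  -- the slice `t = c_j / 1`
  set t : Localization.AtPrime 𝔔.asIdeal := algebraMap (blowupAlgebra (Ideal.span (Set.range c)) (c j))
      (Localization.AtPrime 𝔔.asIdeal) (algebraMap A (blowupAlgebra (Ideal.span (Set.range c)) (c j)) (c j)) with ht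
  have hcj𝔪 : c j ∈ maximalIdeal A := by
    rw [← hrad]; exact Ideal.le_radical (Ideal.subset_span ⟨j, rfl⟩)
  have hcj𝔔 : algebraMap A (blowupAlgebra (Ideal.span (Set.range c)) (c j)) (c j) ∈ 𝔔.asIdeal := by
    have h' : c j ∈ 𝔔.asIdeal.comap (algebraMap A (blowupAlgebra (Ideal.span (Set.range c)) (c j))) := by
      rw [h𝔔]; exact hcj𝔪
    exact Ideal.mem_comap.mp h'
  have ht𝔪 : t ∈ maximalIdeal (Localization.AtPrime 𝔔.asIdeal) := by
    rw [ht]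
    exact (IsLocalization.AtPrime.to_map_mem_maximal_iff (Localization.AtPrime 𝔔.asIdeal) 𝔔.asIdeal _).mpr hcj𝔔
  have ht0 : t ≠ 0 := by
    rw [ht]
    intro h
    have hinj : Function.Injective (algebraMap (blowupAlgebra (Ideal.span (Set.range c)) (c j))
        (Localization.AtPrime 𝔔.asIdeal)) :=
      IsLocalization.injective (Localization.AtPrime 𝔔.asIdeal) (Ideal.primeCompl_le_nonZeroDivisors 𝔔.asIdeal)
    have h0 : algebraMap A (blowupAlgebra (Ideal.span (Set.range c)) (c j)) (c j) = 0 :=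
      hinj (by rw [h, map_zero])
    exact nonZeroDivisors.ne_zero algebraMap_mem_nonZeroDivisors_blowupAlgebra h0
  have htnzd : t ∈ nonZeroDivisors (Localization.AtPrime 𝔔.asIdeal) := mem_nonZeroDivisors_of_ne_zero ht0
  obtain ⟨hCM, hFI⟩ := hE j 𝔔 h𝔔 (Localization.AtPrime 𝔔.asIdeal)
  have h := hFed p hp (Localization.AtPrime 𝔔.asIdeal) t ht𝔪 htnzd hCM hFI
  exact ⟨hLdom, fun d hd s hs => ⟨h.1 d hd s hs, h.2 d hd s hs⟩⟩

/-! ## (v2, appended) CMFI DEFORMS is already a tree theorem ⇒ R1 is UNCONDITIONAL -/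

/-- **«CM + F-injective deforms along a nonzerodivisor» in clause form (split) — a THEOREM of the tree**: repackaging of
`Deformation.cmfi_of_cmfi_quotient` (this crux's `…Deformation` file, 2026-08-17: Fedder 1983 Thm. 3.4 (1), CM case, via `dim R = dim R/t + 1`,
lifted systems of parameters and `OneSop`) from `[Fact p.Prime]` / merged clause to `p.Prime →` / CM-clause ∧ F-clause. Its statement is,
token for token, the hypothesis `hFed` of `pfixData_of_exceptionalSlices` (= the body of `SliceableCentre.CMFIDeforms`, p548504, and of FACT F-90
`Literature.RingTheory.TightClosure.CMFIDeforms`, p548496; finding res-L1-w45a-stub-1 2026-08-27T16:37:42Z).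
[cite: Fedder1983, Thm. 3.4 (1)] [cite: Matsumura1987, Thm. 17.3] -/
theorem cmfiDeforms_clause : ∀ (p : ℕ), p.Prime → ∀ (R : Type) [CommRing R] [IsNoetherianRing R] [IsLocalRing R] [CharP R p] (t : R),
      t ∈ maximalIdeal R → t ∈ nonZeroDivisors R →
      (∀ d : ℕ, ringKrullDim (R ⧸ Ideal.span {t}) = d → ∀ s : Fin d → (R ⧸ Ideal.span {t}), (Ideal.span (Set.range s)).radical.IsMaximal →
        RingTheory.Sequence.IsWeaklyRegular (R ⧸ Ideal.span {t}) (List.ofFn s)) →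
      (∀ d : ℕ, ringKrullDim (R ⧸ Ideal.span {t}) = d → ∀ s : Fin d → (R ⧸ Ideal.span {t}), (Ideal.span (Set.range s)).radical.IsMaximal →
        ∀ y : (R ⧸ Ideal.span {t}), (∃ e : ℕ, y ^ p ^ e ∈ Ideal.span ((fun z : (R ⧸ Ideal.span {t}) => z ^ p ^ e) '' (Ideal.span (Set.range s) : Set (R ⧸ Ideal.span {t})))) →
          y ∈ Ideal.span (Set.range s)) →
      (∀ d : ℕ, ringKrullDim R = d → ∀ s : Fin d → R, (Ideal.span (Set.range s)).radical.IsMaximal →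
        RingTheory.Sequence.IsWeaklyRegular R (List.ofFn s)) ∧
      (∀ d : ℕ, ringKrullDim R = d → ∀ s : Fin d → R, (Ideal.span (Set.range s)).radical.IsMaximal →
        ∀ y : R, (∃ e : ℕ, y ^ p ^ e ∈ Ideal.span ((fun z : R => z ^ p ^ e) '' (Ideal.span (Set.range s) : Set R))) →
          y ∈ Ideal.span (Set.range s)) := by
  intro p hp R _ _ _ _ t htm ht hCM hF
  haveI : Fact p.Prime := ⟨hp⟩
  have h := Deformation.cmfi_of_cmfi_quotient p R t htm ht (fun d hd s hs => ⟨hCM d hd s hs, hF d hd s hs⟩)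
  exact ⟨fun d hd s hs => (h d hd s hs).1, fun d hd s hs => (h d hd s hs).2⟩

/-- **R1 UNCONDITIONAL (chart form): exceptional slices CM-clause + F-clause over `𝔪` ⇒ `(c)` is a PFix-centre.** `pfixData_of_exceptionalSlices`
with `hFed := cmfiDeforms_clause`. So the class «reduced, Cohen–Macaulay, F-injective projectivised tangent / normal cone» has 5e⁺ at `b` in ONE
blowing up, with no named fact left. [OURS assembly over the tree] [cite: Fedder1983, Thm. 3.4 (1)] [cite: StacksProject, Tag 07Z3] -/
theorem pfixData_of_exceptionalSlices_holds {p : ℕ} (hp : p.Prime)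
    {A : Type} [CommRing A] [IsDomain A] [IsNoetherianRing A] [IsLocalRing A] [CharP A p]
    {n : ℕ} (c : Fin n → A) (hc0 : ∀ j, c j ≠ 0) (hne : Ideal.span (Set.range c) ≠ ⊥)
    (hrad : (Ideal.span (Set.range c)).radical = maximalIdeal A)
    (hE : ∀ (j : Fin n) (𝔔 : PrimeSpectrum (blowupAlgebra (Ideal.span (Set.range c)) (c j))),
      𝔔.asIdeal.comap (algebraMap A (blowupAlgebra (Ideal.span (Set.range c)) (c j))) = maximalIdeal A →
        ∀ (L : Type) [CommRing L] [Algebra (blowupAlgebra (Ideal.span (Set.range c)) (c j)) L]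
          [IsLocalization.AtPrime L 𝔔.asIdeal],
        (∀ d : ℕ, ringKrullDim (L ⧸ Ideal.span {algebraMap (blowupAlgebra (Ideal.span (Set.range c)) (c j)) L (algebraMap A (blowupAlgebra (Ideal.span (Set.range c)) (c j)) (c j))}) = d → ∀ s : Fin d → (L ⧸ Ideal.span {algebraMap (blowupAlgebra (Ideal.span (Set.range c)) (c j)) L (algebraMap A (blowupAlgebra (Ideal.span (Set.range c)) (c j)) (c j))}), (Ideal.span (Set.range s)).radical.IsMaximal →
          RingTheory.Sequence.IsWeaklyRegular (L ⧸ Ideal.span {algebraMap (blowupAlgebra (Ideal.span (Set.range c)) (c j)) L (algebraMap A (blowupAlgebra (Ideal.span (Set.range c)) (c j)) (c j))}) (List.ofFn s)) ∧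
        (∀ d : ℕ, ringKrullDim (L ⧸ Ideal.span {algebraMap (blowupAlgebra (Ideal.span (Set.range c)) (c j)) L (algebraMap A (blowupAlgebra (Ideal.span (Set.range c)) (c j)) (c j))}) = d → ∀ s : Fin d → (L ⧸ Ideal.span {algebraMap (blowupAlgebra (Ideal.span (Set.range c)) (c j)) L (algebraMap A (blowupAlgebra (Ideal.span (Set.range c)) (c j)) (c j))}), (Ideal.span (Set.range s)).radical.IsMaximal →
          ∀ y : (L ⧸ Ideal.span {algebraMap (blowupAlgebra (Ideal.span (Set.range c)) (c j)) L (algebraMap A (blowupAlgebra (Ideal.span (Set.range c)) (c j)) (c j))}), (∃ e : ℕ, y ^ p ^ e ∈ Ideal.span ((fun z : (L ⧸ Ideal.span {algebraMap (blowupAlgebra (Ideal.span (Set.range c)) (c j)) L (algebraMap A (blowupAlgebra (Ideal.span (Set.range c)) (c j)) (c j))}) => z ^ p ^ e) '' (Ideal.span (Set.range s) : Set (L ⧸ Ideal.span {algebraMap (blowupAlgebra (Ideal.span (Set.range c)) (c j)) L (algebraMap A (blowupAlgebra (Ideal.span (Set.range c)) (c j)) (c j))})))) →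
            y ∈ Ideal.span (Set.range s))) :
    ∃ (n : ℕ) (c : Fin n → A), Ideal.span (Set.range c) ≠ ⊥ ∧ (Ideal.span (Set.range c)).radical = maximalIdeal A ∧
      ∀ (j : Fin n) (𝔔 : PrimeSpectrum (blowupAlgebra (Ideal.span (Set.range c)) (c j))),
        𝔔.asIdeal.comap (algebraMap A (blowupAlgebra (Ideal.span (Set.range c)) (c j))) = maximalIdeal A →
        (IsDomain (Localization.AtPrime 𝔔.asIdeal) ∧ ∀ d : ℕ, ringKrullDim (Localization.AtPrime 𝔔.asIdeal) = d → ∀ s : Fin d → (Localization.AtPrime 𝔔.asIdeal), (Ideal.span (Set.range s)).radical.IsMaximal →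
          RingTheory.Sequence.IsWeaklyRegular (Localization.AtPrime 𝔔.asIdeal) (List.ofFn s) ∧
          ∀ y : (Localization.AtPrime 𝔔.asIdeal), (∃ e : ℕ, y ^ p ^ e ∈ Ideal.span ((fun z : (Localization.AtPrime 𝔔.asIdeal) => z ^ p ^ e) '' (Ideal.span (Set.range s) : Set (Localization.AtPrime 𝔔.asIdeal)))) →
            y ∈ Ideal.span (Set.range s)) :=
  pfixData_of_exceptionalSlices cmfiDeforms_clause hp c hc0 hne hrad hE

end Summit.ResolutionOfSingularities.ResolutionOfSingularities.Theorems.FInjectiveMacaulayfication.ExceptionalSlices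

end
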